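import Summits.Langlands.Langlands.Theorems.SoloBlindSignPattern

/-!
# SoloBlindSignPatternGeneral — sign-pattern rigidity for any number of quadratic factors

Solo seat `solo-Langlands-blind` (blind mode), session 7.  Pure commutative algebra over a field `K`
with `2 ≠ 0`, generalising `SoloBlindSignPattern` (three factors) to an arbitrary finite family of
factors with multiplicities.  It is the finite step of Theorem B̃ of this seat's dihedral descent for
an arbitrary odd degree `g` (paper/dihedral-descent.md §5.4, §5.11): at a Frobenius element the
twisted identities `(*_μ)` compare `∏_i (X² - e_i T_i X + D_i)^{n_i}` (sign-twisted characteristic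
polynomials of the conjugates of the phantom representation, with multiplicities `n_i` = the number
of conjugates through the same place) with `∏_i (X² - e_i t_i X + d)^{n_i}` (sign-twisted Hecke
polynomials, common constant term `d = q^m` because the central character is trivial), for every
sign vector `e` realised by a quadratic Hecke character: the all-plus vector and the single flips
at every index of a set `S` whose complement has at most one element (split-completely and
rotation-type primes: `S` = everything; reflection-type primes: the one index over the degree-one
place of `K` cannot be flipped and carries multiplicity `1`, the others multiplicity `2`).

* `quad_prod_pow_signPattern`: under these identities `T_i = t_i` and `D_i = d` for every `i`.
* `quad_prod_pow_signPattern_univ`, `quad_prod_pow_signPattern_erase`: the two shapes used.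

Mechanism: a single flip at `k` gives, after cross-multiplication and cancellation in the domain
`K[X]`, `(p_k q_k⁻)^{n_k} = (p_k⁻ q_k)^{n_k}`, hence `p_k q_k⁻ = p_k⁻ q_k` (monic polynomials with
equal powers are equal: unique factorisation), whose odd coefficients give `T_k = t_k` and
`T_k (D_k - d) = 0`; the unflippable index is reached through the involution `X ↦ -X`, under which
every remaining factor is either already matched or even; the constant terms of the trace-zero
factors are then read off from an irreducible factor of `X² + D_i` dividing a power of `X² + d`.
No number theory is used.
-/

namespace Summit.Langlands.Langlands.Theorems
namespace SoloBlind

open Polynomial Finset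

section SignPatternGeneral

variable {K : Type*} [Field K]

/-- `quad a b = X² - a X + b` is monic. -/
theorem monic_quad (a b : K) : (quad a b).Monic := by
  unfold quad
  monicity!

/-- `quad a b` has degree two. -/
theorem natDegree_quad (a b : K) : (quad a b).natDegree = 2 := by
  unfold quad
  compute_degree!

/-- `quad a b ≠ 0`. -/
theorem quad_ne_zero (a b : K) : quad a b ≠ 0 := (monic_quad a b).ne_zero

/-- `quad a b` is not a unit of `K[X]`. -/
theorem not_isUnit_quad (a b : K) : ¬IsUnit (quad a b) :=
  not_isUnit_of_natDegree_pos _ (by rw [natDegree_quad]; norm_num)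

/-- The involution `X ↦ -X` flips the sign of the trace: `(X² - aX + b) ∘ (-X) = X² + aX + b`. -/
theorem quad_comp_neg_X (a b : K) : (quad a b).comp (-X) = quad (-a) b := by
  simp only [quad, sub_comp, add_comp, mul_comp, pow_comp, X_comp, C_comp, map_neg]
  ring

/-- The product of two monic quadratics, in alternating-sign quartic normal form. -/
theorem quad_mul_quad (a b a' b' : K) :
    quad a b * quad a' b' =
      X ^ 4 - C (a + a') * X ^ 3 + C (b + b' + a * a') * X ^ 2 - C (a * b' + a' * b) * X
        + C (b * b') := by
  simp only [quad, map_add, map_mul]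
  ring

/-- The odd coefficients of a quartic in alternating-sign normal form. -/
theorem quartic_coeff_odd {c₃ c₂ c₁ c₀ c₃' c₂' c₁' c₀' : K}
    (h : (X ^ 4 - C c₃ * X ^ 3 + C c₂ * X ^ 2 - C c₁ * X + C c₀ : K[X]) =
      X ^ 4 - C c₃' * X ^ 3 + C c₂' * X ^ 2 - C c₁' * X + C c₀') : c₃ = c₃' ∧ c₁ = c₁' := by
  have h3 := congrArg (fun p : K[X] => p.coeff 3) h
  have h1 := congrArg (fun p : K[X] => p.coeff 1) h
  simp only [coeff_add, coeff_sub, coeff_C_mul, coeff_X_pow, coeff_C, coeff_X] at h3 h1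
  norm_num at h3 h1
  exact ⟨h3, h1⟩

/-- **Cross identity.** `p q⁻ = p⁻ q` for `p = X² - TX + D`, `q = X² - tX + d` (and `⁻` the sign
flip of the trace) forces `T = t` and `T (D - d) = 0` when `2 ≠ 0`. -/
theorem quad_cross (h2 : (2 : K) ≠ 0) {T D t d : K}
    (h : quad T D * quad (-t) d = quad (-T) D * quad t d) : T = t ∧ T * (D - d) = 0 := by
  rw [quad_mul_quad, quad_mul_quad] at h
  obtain ⟨h3, h1⟩ := quartic_coeff_odd h
  have cancel2 : ∀ {x : K}, (2 : K) * x = 0 → x = 0 := fun hx =>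
    (mul_eq_zero.mp hx).resolve_left h2
  have hT : T = t := by
    have h' : (2 : K) * (T - t) = 0 := by linear_combination h3
    exact sub_eq_zero.mp (cancel2 h')
  refine ⟨hT, cancel2 ?_⟩
  rw [← hT] at h1
  linear_combination -h1

/-- **Monic polynomials with equal `n`-th powers are equal** (`n ≠ 0`; unique factorisation in
`K[X]`: the normalised factor multisets satisfy `n • F(p) = n • F(q)`). -/
theorem eq_of_monic_of_pow_eq {n : ℕ} (hn : n ≠ 0) {p q : K[X]} (hp : p.Monic) (hq : q.Monic)
    (h : p ^ n = q ^ n) : p = q := by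
  classical
  have hf : UniqueFactorizationMonoid.normalizedFactors p =
      UniqueFactorizationMonoid.normalizedFactors q := by
    have e := congrArg UniqueFactorizationMonoid.normalizedFactors h
    rw [UniqueFactorizationMonoid.normalizedFactors_pow,
      UniqueFactorizationMonoid.normalizedFactors_pow] at e
    ext a
    have hc := congrArg (Multiset.count a) e
    rw [Multiset.count_nsmul, Multiset.count_nsmul] at hc
    exact Nat.eq_of_mul_eq_mul_left (Nat.pos_of_ne_zero hn) hc
  have h₁ := UniqueFactorizationMonoid.prod_normalizedFactors hp.ne_zero
  have h₂ := UniqueFactorizationMonoid.prod_normalizedFactors hq.ne_zero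
  rw [hf] at h₁
  exact eq_of_monic_of_associated hp hq (h₁.symm.trans h₂)

/-- Cross-multiplication: from `Pⁿ A = Qⁿ B`, `P'ⁿ A' = Q'ⁿ B'` and `A B' = A' B` with `A, B' ≠ 0`
one gets `(P Q')ⁿ = (P' Q)ⁿ`. -/
theorem pow_mul_eq_of_pair {A A' B B' P P' Q Q' : K[X]} {n : ℕ} (hA : A ≠ 0) (hB' : B' ≠ 0)
    (h₁ : P ^ n * A = Q ^ n * B) (h₂ : P' ^ n * A' = Q' ^ n * B') (h₃ : A * B' = A' * B) :
    (P * Q') ^ n = (P' * Q) ^ n := by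
  have key : (P * Q') ^ n * (A * B') = (P' * Q) ^ n * (A * B') := by
    calc (P * Q') ^ n * (A * B') = (P ^ n * A) * Q' ^ n * B' := by ring
      _ = (Q ^ n * B) * Q' ^ n * B' := by rw [h₁]
      _ = Q ^ n * (Q' ^ n * B') * B := by ring
      _ = Q ^ n * (P' ^ n * A') * B := by rw [h₂]
      _ = (P' * Q) ^ n * (A' * B) := by ring
      _ = (P' * Q) ^ n * (A * B') := by rw [h₃]
  exact mul_right_cancel₀ (mul_ne_zero hA hB') key

/-- **One index.** If `p^n A = q^n B` and `(p⁻)^n A' = (q⁻)^n B'` with `A B' = A' B`, `A, B' ≠ 0`,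
`n ≠ 0`, then `T = t` and `T (D - d) = 0`. -/
theorem signPattern_index (h2 : (2 : K) ≠ 0) {A A' B B' : K[X]} {T D t d : K} {n : ℕ}
    (hn : n ≠ 0) (hA : A ≠ 0) (hB' : B' ≠ 0)
    (h₁ : quad T D ^ n * A = quad t d ^ n * B)
    (h₂ : quad (-T) D ^ n * A' = quad (-t) d ^ n * B') (h₃ : A * B' = A' * B) :
    T = t ∧ T * (D - d) = 0 := by
  have hpow := pow_mul_eq_of_pair hA hB' h₁ h₂ h₃
  have heq := eq_of_monic_of_pow_eq hn ((monic_quad _ _).mul (monic_quad _ _))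
    ((monic_quad _ _).mul (monic_quad _ _)) hpow
  exact quad_cross h2 heq

/-- **Constant terms.** If `X² + D` divides a power of `X² + d` then `D = d` (an irreducible factor
of `X² + D` divides `X² + d`, hence the constant `d - D`). -/
theorem eq_of_quad_zero_dvd_pow {D d : K} {N : ℕ} (h : quad (0 : K) D ∣ quad 0 d ^ N) : D = d := by
  classical
  obtain ⟨r, hr, hrD⟩ := WfDvdMonoid.exists_irreducible_factor (not_isUnit_quad (0 : K) D)
    (quad_ne_zero 0 D)
  have hprime : Prime r := hr.prime
  have h₁ : r ∣ quad 0 d := hprime.dvd_of_dvd_pow (hrD.trans h)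
  have h₂ : r ∣ quad (0 : K) d - quad 0 D := dvd_sub h₁ hrD
  have h₃ : quad (0 : K) d - quad 0 D = C (d - D) := by
    simp only [quad, map_zero, zero_mul, sub_zero, map_sub]
    ring
  rw [h₃] at h₂
  by_contra hne
  have hu : IsUnit (C (d - D)) :=
    isUnit_C.mpr (isUnit_iff_ne_zero.mpr (sub_ne_zero.mpr (fun e => hne e.symm)))
  exact hr.not_isUnit (isUnit_of_dvd_unit h₂ hu)

/-- **Sign-pattern rigidity, general form.**  Index set `ι` (finite), multiplicities `n i ≠ 0`, traces
`T, t`, constant terms `D` and a COMMON constant term `d` on the Hecke side, and a set `S` of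
flippable indices whose complement has at most one element.  If
`∏ i, (X² - T_i X + D_i)^{n_i} = ∏ i, (X² - t_i X + d)^{n_i}` (the all-plus sign vector) and, for every
`k ∈ S`, the same identity with the `k`-th traces replaced by `-T_k`, `-t_k` (a single flip), then
`T_i = t_i` and `D_i = d` for every `i`.  The common `d` is necessary (see `SoloBlindSignPattern`). -/
theorem quad_prod_pow_signPattern (h2 : (2 : K) ≠ 0) {ι : Type*} [Fintype ι] [DecidableEq ι]
    {n : ι → ℕ} (hn : ∀ i, n i ≠ 0) {T D t : ι → K} {d : K} {S : Finset ι}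
    (hS : ∀ i ∉ S, ∀ j ∉ S, i = j)
    (h₁ : ∏ i, quad (T i) (D i) ^ n i = ∏ i, quad (t i) d ^ n i)
    (hflip : ∀ k ∈ S,
      quad (-T k) (D k) ^ n k * ∏ i ∈ univ.erase k, quad (T i) (D i) ^ n i =
        quad (-t k) d ^ n k * ∏ i ∈ univ.erase k, quad (t i) d ^ n i) :
    ∀ i, T i = t i ∧ D i = d := by
  classical
  have hf0 : ∀ s : Finset ι, ∏ i ∈ s, quad (T i) (D i) ^ n i ≠ 0 :=
    fun s => prod_ne_zero_iff.mpr fun i _ => pow_ne_zero _ (quad_ne_zero _ _)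
  have hg0 : ∀ s : Finset ι, ∏ i ∈ s, quad (t i) d ^ n i ≠ 0 :=
    fun s => prod_ne_zero_iff.mpr fun i _ => pow_ne_zero _ (quad_ne_zero _ _)
  -- the all-plus identity with the `k`-th factor pulled out
  have hsplit : ∀ k, quad (T k) (D k) ^ n k * ∏ i ∈ univ.erase k, quad (T i) (D i) ^ n i =
      quad (t k) d ^ n k * ∏ i ∈ univ.erase k, quad (t i) d ^ n i := by
    intro k
    rw [mul_prod_erase univ (fun i => quad (T i) (D i) ^ n i) (mem_univ k),
      mul_prod_erase univ (fun i => quad (t i) d ^ n i) (mem_univ k)]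
    exact h₁
  -- Step 1: flippable indices
  have step1 : ∀ k ∈ S, T k = t k ∧ T k * (D k - d) = 0 := fun k hk =>
    signPattern_index h2 (hn k) (hf0 _) (hg0 _) (hsplit k) (hflip k hk) rfl
  -- Step 2: every index (the possible unflippable one through `X ↦ -X`)
  have step2 : ∀ k, T k = t k ∧ T k * (D k - d) = 0 := by
    intro k
    by_cases hk : k ∈ S
    · exact step1 k hk
    have hothers : ∀ i, i ≠ k → i ∈ S := fun i hik => by
      by_contra hi
      exact hik (hS i hi k hk)
    let φ : K[X] →+* K[X] := compRingHom (-X)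
    have hφ : ∀ a b : K, φ (quad a b) = quad (-a) b := fun a b => by
      show (quad a b).comp (-X) = quad (-a) b
      exact quad_comp_neg_X a b
    -- for `i ∈ S` the factors are either matched or even
    have hpair : ∀ i ∈ S, quad (T i) (D i) ^ n i * φ (quad (t i) d ^ n i) =
        φ (quad (T i) (D i) ^ n i) * quad (t i) d ^ n i := by
      intro i hi
      obtain ⟨hTt, hTD⟩ := step1 i hi
      rw [map_pow, map_pow, hφ, hφ]
      rcases mul_eq_zero.mp hTD with hT0 | hDd
      · have ht0 : t i = 0 := by rw [← hTt]; exact hT0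
        rw [hT0, ht0, neg_zero]
      · have hDi : D i = d := sub_eq_zero.mp hDd
        rw [hTt, hDi]
        ring
    have e₂ : quad (-T k) (D k) ^ n k * ∏ i ∈ univ.erase k, φ (quad (T i) (D i) ^ n i) =
        quad (-t k) d ^ n k * ∏ i ∈ univ.erase k, φ (quad (t i) d ^ n i) := by
      have e := congrArg φ (hsplit k)
      rw [map_mul, map_mul, map_pow, map_pow, hφ, hφ, map_prod, map_prod] at e
      exact e
    have e₃ : (∏ i ∈ univ.erase k, quad (T i) (D i) ^ n i) *
        (∏ i ∈ univ.erase k, φ (quad (t i) d ^ n i)) =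
        (∏ i ∈ univ.erase k, φ (quad (T i) (D i) ^ n i)) *
          ∏ i ∈ univ.erase k, quad (t i) d ^ n i := by
      rw [← prod_mul_distrib, ← prod_mul_distrib]
      exact prod_congr rfl fun i hi => hpair i (hothers i (ne_of_mem_erase hi))
    have hφ0 : ∏ i ∈ univ.erase k, φ (quad (t i) d ^ n i) ≠ 0 :=
      prod_ne_zero_iff.mpr fun i _ => by
        rw [map_pow, hφ]
        exact pow_ne_zero _ (quad_ne_zero _ _)
    exact signPattern_index h2 (hn k) (hf0 _) hφ0 (hsplit k) e₂ e₃
  have hT : ∀ i, T i = t i := fun i => (step2 i).1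
  have hDof : ∀ i, T i ≠ 0 → D i = d := fun i hTi =>
    sub_eq_zero.mp ((mul_eq_zero.mp (step2 i).2).resolve_left hTi)
  -- Step 3: cancel the matched factors (those with `T i ≠ 0`)
  have h₄ : ∏ i ∈ univ.filter (fun i => T i = 0), quad (T i) (D i) ^ n i =
      ∏ i ∈ univ.filter (fun i => T i = 0), quad (t i) d ^ n i := by
    have ha := prod_filter_mul_prod_filter_not univ (fun i => T i = 0)
      (fun i => quad (T i) (D i) ^ n i)
    have hb := prod_filter_mul_prod_filter_not univ (fun i => T i = 0)
      (fun i => quad (t i) d ^ n i)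
    have hc : ∏ i ∈ univ.filter (fun i => ¬T i = 0), quad (T i) (D i) ^ n i =
        ∏ i ∈ univ.filter (fun i => ¬T i = 0), quad (t i) d ^ n i :=
      prod_congr rfl fun i hi => by
        rw [hT i, hDof i (mem_filter.mp hi).2]
    have e : (∏ i ∈ univ.filter (fun i => T i = 0), quad (T i) (D i) ^ n i) *
        ∏ i ∈ univ.filter (fun i => ¬T i = 0), quad (t i) d ^ n i =
        (∏ i ∈ univ.filter (fun i => T i = 0), quad (t i) d ^ n i) *
          ∏ i ∈ univ.filter (fun i => ¬T i = 0), quad (t i) d ^ n i :=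
      calc (∏ i ∈ univ.filter (fun i => T i = 0), quad (T i) (D i) ^ n i) *
            ∏ i ∈ univ.filter (fun i => ¬T i = 0), quad (t i) d ^ n i =
          (∏ i ∈ univ.filter (fun i => T i = 0), quad (T i) (D i) ^ n i) *
            ∏ i ∈ univ.filter (fun i => ¬T i = 0), quad (T i) (D i) ^ n i := by rw [hc]
        _ = ∏ i, quad (T i) (D i) ^ n i := ha
        _ = ∏ i, quad (t i) d ^ n i := h₁
        _ = (∏ i ∈ univ.filter (fun i => T i = 0), quad (t i) d ^ n i) *
            ∏ i ∈ univ.filter (fun i => ¬T i = 0), quad (t i) d ^ n i := hb.symm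
    exact mul_right_cancel₀ (hg0 _) e
  -- Step 4: constant terms of the trace-zero factors
  intro i
  refine ⟨hT i, ?_⟩
  by_cases hTi : T i = 0
  · have hmem : i ∈ univ.filter (fun i => T i = 0) := mem_filter.mpr ⟨mem_univ _, hTi⟩
    have hrhs : ∏ j ∈ univ.filter (fun j => T j = 0), quad (t j) d ^ n j =
        quad 0 d ^ ∑ j ∈ univ.filter (fun j => T j = 0), n j := by
      rw [← prod_pow_eq_pow_sum]
      refine prod_congr rfl fun j hj => ?_
      have htj : t j = 0 := by rw [← hT j]; exact (mem_filter.mp hj).2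
      rw [htj]
    have hdvd : quad (0 : K) (D i) ∣ quad 0 d ^ ∑ j ∈ univ.filter (fun j => T j = 0), n j := by
      have d₁ : quad (0 : K) (D i) ∣ quad (T i) (D i) ^ n i := by
        rw [hTi]
        exact dvd_pow_self _ (hn i)
      rw [← hrhs, ← h₄]
      exact d₁.trans (dvd_prod_of_mem (fun j => quad (T j) (D j) ^ n j) hmem)
    exact eq_of_quad_zero_dvd_pow hdvd
  · exact hDof i hTi

/-- **All indices flippable** (split-completely and rotation-type primes: every place of `K` over
the prime splits in `K̃/K`, every sign vector is realised; multiplicities `n i` = the order of the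
Frobenius rotation). -/
theorem quad_prod_pow_signPattern_univ (h2 : (2 : K) ≠ 0) {ι : Type*} [Fintype ι] [DecidableEq ι]
    {n : ι → ℕ} (hn : ∀ i, n i ≠ 0) {T D t : ι → K} {d : K}
    (h₁ : ∏ i, quad (T i) (D i) ^ n i = ∏ i, quad (t i) d ^ n i)
    (hflip : ∀ k,
      quad (-T k) (D k) ^ n k * ∏ i ∈ univ.erase k, quad (T i) (D i) ^ n i =
        quad (-t k) d ^ n k * ∏ i ∈ univ.erase k, quad (t i) d ^ n i) :
    ∀ i, T i = t i ∧ D i = d :=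
  quad_prod_pow_signPattern h2 hn (S := univ) (fun i hi _ _ => absurd (mem_univ i) hi) h₁
    fun k _ => hflip k

/-- **One unflippable index** (reflection-type primes: the index `o` over the degree-one place of
`K`, inert in `K̃/K`, always carries the sign `+1`; the other indices, over the degree-two places,
carry multiplicity `n i = 2` and free signs). -/
theorem quad_prod_pow_signPattern_erase (h2 : (2 : K) ≠ 0) {ι : Type*} [Fintype ι]
    [DecidableEq ι] {n : ι → ℕ} (hn : ∀ i, n i ≠ 0) {T D t : ι → K} {d : K} (o : ι)
    (h₁ : ∏ i, quad (T i) (D i) ^ n i = ∏ i, quad (t i) d ^ n i)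
    (hflip : ∀ k, k ≠ o →
      quad (-T k) (D k) ^ n k * ∏ i ∈ univ.erase k, quad (T i) (D i) ^ n i =
        quad (-t k) d ^ n k * ∏ i ∈ univ.erase k, quad (t i) d ^ n i) :
    ∀ i, T i = t i ∧ D i = d :=
  quad_prod_pow_signPattern h2 hn (S := univ.erase o)
    (fun i hi j hj => by
      rw [mem_erase, not_and_or, not_not] at hi hj
      rcases hi with hi | hi
      · rcases hj with hj | hj
        · exact hi.trans hj.symm
        · exact absurd (mem_univ j) hj
      · exact absurd (mem_univ i) hi)
    h₁ fun k hk => hflip k (ne_of_mem_erase hk)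

end SignPatternGeneral

end SoloBlind
end Summit.Langlands.Langlands.Theorems
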